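import Summits.AtomisticToContinuum.Crystallization.Theorems.SquareWellLayerCakeGapTwelveToBarlowCombinatorialLayeringTransportSteps1
import Summits.AtomisticToContinuum.Crystallization.Theorems.SquareWellLayerCakeGapTwelveToBarlowCombinatorialLayeringTransportSteps6
import Summits.AtomisticToContinuum.Crystallization.Theorems.SquareWellLayerCakeGapTwelveToBarlowCombinatorialLayeringTransportSteps7
import Summits.AtomisticToContinuum.Crystallization.Theorems.SquareWellLayerCakeGapTwelveToBarlowCombinatorialLayeringTransportLower

/-!
# Combinatorial layering (B1a of `GapTwelveToBarlow`): transport port, part `Vinv`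

Crux `SquareWellLayerCake.GapTwelveToBarlow` (stmt-AtomisticToContinuum-15807), line `Sketch`,
stub `stub_combinatorialLayering`, residual `(H_develop)`.  PORT of the tree file
`PalmUnimodularRigidityShellsToBarlowChartTransportVinv.lean` (crux 9227) to GRADED COMBINATORIAL
charts, following the port rules recorded in `…CombinatorialLayeringTransportSteps1` (bundled
standing hypothesis `hch` on `S : ℕ → Set E3`, abstract bond relation `B`, memberships
`x ∈ S (n + k)`, transfer as an input).  Statements and proofs are otherwise those of the source,
whose documentation follows.

# Line `develop-the-model-growth-descent` (crux `ShellsToBarlowChart`, stmt-AtomisticToContinuum-9227): the downward transport `V⁻¹` (specification)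

Helper lemmas for `stub_transportSystem` (the geometric half of the line): frames `⟨x, t₁, t₂, U⟩`
read in the integer charts `IsZChart` of a good-shell configuration, their transports and the
coherence of the resulting development `frameAt`.  The only metric inputs are the chart transfer
lemma and `bond_nb_iff`; everything else is label combinatorics in `ℤ³` (pattern facts
`TransportPatterns*`).  All `[folklore]` (HalesDSP2012 §1.3 for the two kissing patterns).
-/

noncomputable section

namespace Summit.AtomisticToContinuum.Crystallization.Theorems.SquareWellLayerCakeGapTwelveToBarlow

open Literature.Geometry.DiscreteGeometry Literature.MathematicalPhysics.StatisticalMechanics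
open Summit.AtomisticToContinuum.Crystallization.Theorems.PalmUnimodularRigidityShellsToBarlowChart hiding
  IsZChart TransportSystem scales_tied sqNormInt_transfer bond_symm nb_mem zlab_spec zlab_nb
  bond_nb_iff pattern_cases transfer_nb_nb transfer_nb_centre transfer_nb_target
  sqNormInt_zlab_centre hcp_of_mirror_pair Istep_spec Jstep_spec IinvStep_spec JinvStep_spec
  capWithAny_of_mem_cap IinvStep_Istep Istep_IinvStep JinvStep_Jstep Jstep_JinvStep polar_at_apex
  onesided_at_apex Vstep_spec nb_inj Istep_lower Jstep_lower IinvStep_lower JinvStep_lower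
  polar_at_lower_apex onesided_at_lower_apex VinvStep_spec attach_I_even attach_I_odd
  attach_lower_I_pos attach_lower_I_neg attach_J_even attach_J_odd Vstep_Istep_pt Vstep_Istep_back
  Vstep_Istep_side Vstep_Jstep_pt Vstep_Istep_comm Vstep_Jstep_comm attach_lower_J_pos
  attach_lower_J_neg VinvStep_Istep_pt VinvStep_Jstep_pt VinvStep_Istep_back VinvStep_Istep_side
  VinvStep_Istep_comm VinvStep_Jstep_comm Istep_Jstep_comm

variable {S : ℕ → Set (EuclideanSpace ℝ (Fin 3))}
  {B : EuclideanSpace ℝ (Fin 3) → EuclideanSpace ℝ (Fin 3) → Prop}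
  {Pc : EuclideanSpace ℝ (Fin 3) → Finset (Fin 3 → ℤ)}
  {nb : EuclideanSpace ℝ (Fin 3) → (Fin 3 → ℤ) → EuclideanSpace ℝ (Fin 3)}

variable
  (hch : (∀ n : ℕ, ∀ z ∈ S n, (Pc z = fcc3Int ∨ Pc z = hcpInt) ∧
      Set.BijOn (nb z) (↑(Pc z) : Set (Fin 3 → ℤ)) {y | B z y} ∧
      ∀ t ∈ Pc z, ∀ t' ∈ Pc z, (B (nb z t) (nb z t') ↔ sqNormInt (t - t') = 18)) ∧
    (∀ n : ℕ, ∀ z ∈ S (n + 1), ∀ y, B z y → y ∈ S n) ∧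
    (∀ n m : ℕ, ∀ x ∈ S n, ∀ y ∈ S m, B x y →
      ∀ (z z' : EuclideanSpace ℝ (Fin 3)) (t t' u u' : Fin 3 → ℤ),
        (t = 0 ∧ z = x ∨ t ∈ Pc x ∧ z = nb x t) → (t' = 0 ∧ z' = x ∨ t' ∈ Pc x ∧ z' = nb x t') →
        (u = 0 ∧ z = y ∨ u ∈ Pc y ∧ z = nb y u) → (u' = 0 ∧ z' = y ∨ u' ∈ Pc y ∧ z' = nb y u') →
        sqNormInt (u - u') = sqNormInt (t - t')) ∧
    (∀ x y, B x y → B y x))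

include hch


/-- **Polarity at the lower apex** (mirror of `polar_at_apex`): a site attached to `x` through a
lower-cap label of a valid frame at `x`, if HCP, sees `x` as a polar label. [folklore] -/
theorem polar_at_lower_apex {n : ℕ} {x : (EuclideanSpace ℝ (Fin 3))}
    (hx : x ∈ S (n + 2)) {t₁ t₂ : Fin 3 → ℤ} {U : Finset (Fin 3 → ℤ)} (hU : IsFrame (Pc x) t₁ t₂ U)
    {c : Fin 3 → ℤ} (hcL : c ∈ lowerCap (Pc x) t₁ t₂ U) (hhcp : Pc (nb x c) = hcpInt) :
    -zlab Pc nb (nb x c) x ∉ Pc (nb x c) := by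
  intro hneg
  have hcP : c ∈ Pc x := (mem_lowerCap_iff.1 hcL).1
  have hu := nb_mem hch hx hcP
  have hξ := zlab_spec hch hu.1 hx (bond_symm hch hu.2)
  have hξP : zlab Pc nb (nb x c) x ∈ hcpInt := by rw [← hhcp]; exact hξ.1
  rw [hhcp] at hneg
  obtain ⟨m, hm, n, hn, hξm, hξn, hmn⟩ := exists_mirror_pair_of_equatorial _ hξP hneg
  have hmP : m ∈ Pc (nb x c) := by rw [hhcp]; exact hm
  have hnP : n ∈ Pc (nb x c) := by rw [hhcp]; exact hn
  have hzm := nb_mem hch hu.1 hmP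
  have hzn := nb_mem hch hu.1 hnP
  have hbm : B (nb (nb x c) m) x := by
    have := (bond_nb_iff hch hu.1 hmP hξ.1).2 (by rw [sqNormInt_sub_comm]; exact hξm)
    rwa [hξ.2] at this
  have hbn : B (nb (nb x c) n) x := by
    have := (bond_nb_iff hch hu.1 hnP hξ.1).2 (by rw [sqNormInt_sub_comm]; exact hξn)
    rwa [hξ.2] at this
  have ha := zlab_spec hch hx hzm.1 (bond_symm hch hbm)
  have hb := zlab_spec hch hx hzn.1 (bond_symm hch hbn)
  have hac : sqNormInt (zlab Pc nb x (nb (nb x c) m) - c) = 18 :=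
    (bond_nb_iff hch hx ha.1 hcP).1 (by rw [ha.2]; exact bond_symm hch hzm.2)
  have hbc : sqNormInt (zlab Pc nb x (nb (nb x c) n) - c) = 18 :=
    (bond_nb_iff hch hx hb.1 hcP).1 (by rw [hb.2]; exact bond_symm hch hzn.2)
  have htr := transfer_nb_nb hch hx hu.1 hu.2 ha.1 hb.1 (by rw [ha.2]; exact hzm.2)
    (by rw [hb.2]; exact hzn.2)
  rw [ha.2, hb.2, zlab_nb hch hu.1 hmP, zlab_nb hch hu.1 hnP, hmn] at htr
  exact no_48_around_polar (Pc x) (pattern_cases hch hx) c hcP _ ha.1 _ hb.1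
    (cap_label_polar_or_fcc_lower (pattern_cases hch hx) hU hcL)
    (by rw [sqNormInt_sub_comm]; exact hac) (by rw [sqNormInt_sub_comm]; exact hbc) htr.symm

/-- **One-sidedness at a common lower apex** (mirror of `onesided_at_apex`). [folklore] -/
theorem onesided_at_lower_apex {n : ℕ} {x x' : (EuclideanSpace ℝ (Fin 3))} (hx : x ∈ S (n + 2)) {n' : ℕ} (hx' : x' ∈ S (n' + 2)) {t₁ t₂ t₁' t₂' : Fin 3 → ℤ}
    {U U' : Finset (Fin 3 → ℤ)} (hU : IsFrame (Pc x) t₁ t₂ U) (hU' : IsFrame (Pc x') t₁' t₂' U')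
    {c c' : Fin 3 → ℤ} (hcL : c ∈ lowerCap (Pc x) t₁ t₂ U)
    (hcL' : c' ∈ lowerCap (Pc x') t₁' t₂' U') (heq : nb x c = nb x' c') :
    (-zlab Pc nb (nb x c) x ∈ Pc (nb x c) ∧ -zlab Pc nb (nb x c) x' ∈ Pc (nb x c)) ∨
      (-zlab Pc nb (nb x c) x ∉ Pc (nb x c) ∧ -zlab Pc nb (nb x c) x' ∉ Pc (nb x c)) := by
  have hcP : c ∈ Pc x := (mem_lowerCap_iff.1 hcL).1
  have hcP' : c' ∈ Pc x' := (mem_lowerCap_iff.1 hcL').1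
  have hu := nb_mem hch hx hcP
  have hu' := nb_mem hch hx' hcP'
  have hξ := zlab_spec hch hu.1 hx (bond_symm hch hu.2)
  have hξ' := zlab_spec hch hu.1 hx' (by rw [heq]; exact bond_symm hch hu'.2)
  rcases pattern_cases hch hu.1 with hF | hH
  · left
    rw [hF] at hξ hξ' ⊢
    exact ⟨neg_mem_fcc3Int _ hξ.1, neg_mem_fcc3Int _ hξ'.1⟩
  · right
    refine ⟨polar_at_lower_apex hch hx hU hcL hH, ?_⟩
    have := polar_at_lower_apex hch hx' hU' hcL' (by rw [← heq]; exact hH)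
    rwa [← heq] at this

/-- **The V⁻¹-step** (mirror of `Vstep_spec`).  For a valid frame `g = ⟨x, t₁, t₂, U⟩` whose four
in-layer transports are valid frames, `VinvStep g` lands at the lower apex site `d = nb x c'`
(`c'` the apex of the lower cap `L`), is a valid frame of parity `lowerParity t₁ t₂ L` (the
letter below `x`), and its upper cap consists of the labels at `d` of `x` and of the two in-layer
neighbours of `x` above `d` (`nb x (∓t₁), nb x (∓t₂)`, sign = that letter). [folklore] -/
theorem VinvStep_spec {n : ℕ} {x : (EuclideanSpace ℝ (Fin 3))}
    (hx : x ∈ S (n + 3)) {t₁ t₂ : Fin 3 → ℤ} {U : Finset (Fin 3 → ℤ)} (hU : IsFrame (Pc x) t₁ t₂ U)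
    (hI : IsFrame (Pc (nb x t₁)) (Istep Pc nb ⟨x, t₁, t₂, U⟩).t₁ (Istep Pc nb ⟨x, t₁, t₂, U⟩).t₂
      (Istep Pc nb ⟨x, t₁, t₂, U⟩).U)
    (hJ : IsFrame (Pc (nb x t₂)) (Jstep Pc nb ⟨x, t₁, t₂, U⟩).t₁ (Jstep Pc nb ⟨x, t₁, t₂, U⟩).t₂
      (Jstep Pc nb ⟨x, t₁, t₂, U⟩).U)
    (hIi : IsFrame (Pc (nb x (-t₁))) (IinvStep Pc nb ⟨x, t₁, t₂, U⟩).t₁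
      (IinvStep Pc nb ⟨x, t₁, t₂, U⟩).t₂ (IinvStep Pc nb ⟨x, t₁, t₂, U⟩).U)
    (hJi : IsFrame (Pc (nb x (-t₂))) (JinvStep Pc nb ⟨x, t₁, t₂, U⟩).t₁
      (JinvStep Pc nb ⟨x, t₁, t₂, U⟩).t₂ (JinvStep Pc nb ⟨x, t₁, t₂, U⟩).U) :
    apexOf t₁ t₂ (lowerCap (Pc x) t₁ t₂ U) ∈ lowerCap (Pc x) t₁ t₂ U ∧
    nb x (apexOf t₁ t₂ (lowerCap (Pc x) t₁ t₂ U)) ∈ S (n + 2) ∧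
    (B x (nb x (apexOf t₁ t₂ (lowerCap (Pc x) t₁ t₂ U)))) ∧
    zlab Pc nb (nb x (apexOf t₁ t₂ (lowerCap (Pc x) t₁ t₂ U))) x ∈
      Pc (nb x (apexOf t₁ t₂ (lowerCap (Pc x) t₁ t₂ U))) ∧
    nb (nb x (apexOf t₁ t₂ (lowerCap (Pc x) t₁ t₂ U)))
      (zlab Pc nb (nb x (apexOf t₁ t₂ (lowerCap (Pc x) t₁ t₂ U))) x) = x ∧
    IsFrame (Pc (nb x (apexOf t₁ t₂ (lowerCap (Pc x) t₁ t₂ U)))) (VinvStep Pc nb ⟨x, t₁, t₂, U⟩).t₁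
      (VinvStep Pc nb ⟨x, t₁, t₂, U⟩).t₂ (VinvStep Pc nb ⟨x, t₁, t₂, U⟩).U ∧
    frameParity (VinvStep Pc nb ⟨x, t₁, t₂, U⟩).t₁ (VinvStep Pc nb ⟨x, t₁, t₂, U⟩).t₂
        (VinvStep Pc nb ⟨x, t₁, t₂, U⟩).U = lowerParity t₁ t₂ (lowerCap (Pc x) t₁ t₂ U) ∧
    ((lowerParity t₁ t₂ (lowerCap (Pc x) t₁ t₂ U) = 1 ∧
      (VinvStep Pc nb ⟨x, t₁, t₂, U⟩).U =
        {zlab Pc nb (nb x (apexOf t₁ t₂ (lowerCap (Pc x) t₁ t₂ U))) x,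
          zlab Pc nb (nb x (apexOf t₁ t₂ (lowerCap (Pc x) t₁ t₂ U))) x - (VinvStep Pc nb ⟨x, t₁, t₂, U⟩).t₁,
          zlab Pc nb (nb x (apexOf t₁ t₂ (lowerCap (Pc x) t₁ t₂ U))) x - (VinvStep Pc nb ⟨x, t₁, t₂, U⟩).t₂} ∧
      nb (nb x (apexOf t₁ t₂ (lowerCap (Pc x) t₁ t₂ U)))
          (zlab Pc nb (nb x (apexOf t₁ t₂ (lowerCap (Pc x) t₁ t₂ U))) x -
            (VinvStep Pc nb ⟨x, t₁, t₂, U⟩).t₁) = nb x (-t₁) ∧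
      nb (nb x (apexOf t₁ t₂ (lowerCap (Pc x) t₁ t₂ U)))
          (zlab Pc nb (nb x (apexOf t₁ t₂ (lowerCap (Pc x) t₁ t₂ U))) x -
            (VinvStep Pc nb ⟨x, t₁, t₂, U⟩).t₂) = nb x (-t₂) ∧
      lowerCap (Pc x) t₁ t₂ U = {apexOf t₁ t₂ (lowerCap (Pc x) t₁ t₂ U),
        apexOf t₁ t₂ (lowerCap (Pc x) t₁ t₂ U) + t₁, apexOf t₁ t₂ (lowerCap (Pc x) t₁ t₂ U) + t₂}) ∨
     (lowerParity t₁ t₂ (lowerCap (Pc x) t₁ t₂ U) = -1 ∧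
      (VinvStep Pc nb ⟨x, t₁, t₂, U⟩).U =
        {zlab Pc nb (nb x (apexOf t₁ t₂ (lowerCap (Pc x) t₁ t₂ U))) x,
          zlab Pc nb (nb x (apexOf t₁ t₂ (lowerCap (Pc x) t₁ t₂ U))) x + (VinvStep Pc nb ⟨x, t₁, t₂, U⟩).t₁,
          zlab Pc nb (nb x (apexOf t₁ t₂ (lowerCap (Pc x) t₁ t₂ U))) x + (VinvStep Pc nb ⟨x, t₁, t₂, U⟩).t₂} ∧
      nb (nb x (apexOf t₁ t₂ (lowerCap (Pc x) t₁ t₂ U)))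
          (zlab Pc nb (nb x (apexOf t₁ t₂ (lowerCap (Pc x) t₁ t₂ U))) x +
            (VinvStep Pc nb ⟨x, t₁, t₂, U⟩).t₁) = nb x t₁ ∧
      nb (nb x (apexOf t₁ t₂ (lowerCap (Pc x) t₁ t₂ U)))
          (zlab Pc nb (nb x (apexOf t₁ t₂ (lowerCap (Pc x) t₁ t₂ U))) x +
            (VinvStep Pc nb ⟨x, t₁, t₂, U⟩).t₂) = nb x t₂ ∧
      lowerCap (Pc x) t₁ t₂ U = {apexOf t₁ t₂ (lowerCap (Pc x) t₁ t₂ U),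
        apexOf t₁ t₂ (lowerCap (Pc x) t₁ t₂ U) - t₁, apexOf t₁ t₂ (lowerCap (Pc x) t₁ t₂ U) - t₂})) := by
  obtain ⟨h12, hhex, hUP, hoff, c, hcU, hform⟩ := id hU
  have hPx := pattern_cases hch hx
  have ht₁ : t₁ ∈ Pc x := hhex (mem_hexLabels_iff.2 (Or.inl rfl))
  have ht₂ : t₂ ∈ Pc x := hhex (mem_hexLabels_iff.2 (Or.inr (Or.inl rfl)))
  have hnt₁ : -t₁ ∈ Pc x := hhex (mem_hexLabels_iff.2 (Or.inr (Or.inr (Or.inr (Or.inl rfl)))))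
  have hnt₂ : -t₂ ∈ Pc x :=
    hhex (mem_hexLabels_iff.2 (Or.inr (Or.inr (Or.inr (Or.inr (Or.inl rfl))))))
  obtain ⟨d', hd'L, hd'P, hd'hex, hLcase⟩ := lowerCap_cases hPx hU
  have hLframe : IsFrame (Pc x) t₁ t₂ (lowerCap (Pc x) t₁ t₂ U) := isFrame_lowerCap hPx hU
  have hapexL : apexOf t₁ t₂ (lowerCap (Pc x) t₁ t₂ U) = d' := by
    rcases hLcase with ⟨hLeq, -, -, -⟩ | ⟨hLeq, -, -, -⟩
    · exact apexOf_eq_of_form hPx hLframe hd'L (Or.inr hLeq)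
    · exact apexOf_eq_of_form hPx hLframe hd'L (Or.inl hLeq)
  rw [hapexL]
  have hu := nb_mem hch hx hd'P
  have hPd := pattern_cases hch hu.1
  have hξ := zlab_spec hch hu.1 hx (bond_symm hch hu.2)
  set ξ := zlab Pc nb (nb x d') x with hξ_def
  have hyS : nb x t₁ ∈ S _ := (nb_mem hch hx ht₁).1
  have hy'S : nb x t₂ ∈ S _ := (nb_mem hch hx ht₂).1
  have hymS : nb x (-t₁) ∈ S _ := (nb_mem hch hx hnt₁).1
  have hym'S : nb x (-t₂) ∈ S _ := (nb_mem hch hx hnt₂).1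
  rcases hLcase with ⟨hLeq, hlp, hd1, hd2⟩ | ⟨hLeq, hlp, hd1, hd2⟩
  · /- letter below `+1`: `L = {d', d' + t₁, d' + t₂}`; the upper sites of `d` are `x, I⁻¹x, J⁻¹x` -/
    have hdx := dist_oddCap (Pc x) hPx t₁ ht₁ t₂ ht₂ d' hd'P h12 hhex hd'hex hd1 hd2
    have hbI : B (nb x d') (nb x (-t₁)) :=
      (bond_nb_iff hch hx hd'P hnt₁).2 (by rw [sqNormInt_sub_comm]; exact hdx.1)
    have hbJ : B (nb x d') (nb x (-t₂)) :=
      (bond_nb_iff hch hx hd'P hnt₂).2 (by rw [sqNormInt_sub_comm]; exact hdx.2.1)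
    have hη := zlab_spec hch hu.1 hymS hbI
    have hζ := zlab_spec hch hu.1 hym'S hbJ
    set η := zlab Pc nb (nb x d') (nb x (-t₁)) with hη_def
    set ζ := zlab Pc nb (nb x d') (nb x (-t₂)) with hζ_def
    have Dηξ : sqNormInt (η - ξ) = 18 := by
      rw [hη_def, hξ_def, transfer_nb_centre hch hx hu.1 hu.2 hnt₁ hbI, sqNormInt_neg]
      exact chart_sqNormInt_eq hch hx ht₁
    have Dζξ : sqNormInt (ζ - ξ) = 18 := by
      rw [hζ_def, hξ_def, transfer_nb_centre hch hx hu.1 hu.2 hnt₂ hbJ, sqNormInt_neg]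
      exact chart_sqNormInt_eq hch hx ht₂
    have Dηζ : sqNormInt (η - ζ) = 18 := by
      rw [hη_def, hζ_def, transfer_nb_nb hch hx hu.1 hu.2 hnt₁ hnt₂ hbI hbJ,
        show -t₁ - -t₂ = t₂ - t₁ by abel, sqNormInt_sub_comm]
      exact h12
    -- `d` is attached to `I⁻¹x` and `J⁻¹x` through their LOWER caps
    have hregI : Pc (nb x (-t₁)) = fcc3Int ∨ Pc x = hcpInt ∨
        (-zlab Pc nb (nb x (-t₁)) x ∈ Pc (nb x (-t₁)) ∧
          -zlab Pc nb (nb x (-t₁)) (nb x (t₂ - t₁)) ∈ Pc (nb x (-t₁))) :=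
      Or.inr (Or.inr ⟨hIi.2.1 (mem_hexLabels_iff.2 (Or.inr (Or.inr (Or.inr (Or.inl rfl))))),
        hIi.2.1 (mem_hexLabels_iff.2 (Or.inr (Or.inr (Or.inr (Or.inr (Or.inl rfl))))))⟩)
    have hregJ : Pc (nb x (-t₂)) = fcc3Int ∨ Pc x = hcpInt ∨
        (-zlab Pc nb (nb x (-t₂)) x ∈ Pc (nb x (-t₂)) ∧
          -zlab Pc nb (nb x (-t₂)) (nb x (t₁ - t₂)) ∈ Pc (nb x (-t₂))) :=
      Or.inr (Or.inr ⟨hJi.2.1 (mem_hexLabels_iff.2 (Or.inr (Or.inr (Or.inr (Or.inr (Or.inl rfl)))))),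
        hJi.2.1 (mem_hexLabels_iff.2 (Or.inr (Or.inr (Or.inr (Or.inl rfl)))))⟩)
    obtain ⟨ℓ₁, -, -, hfiltI, hbu₁, -, hlamL₁⟩ := IinvStep_lower hch hx hU hregI
    obtain ⟨ℓ₂, -, -, hfiltJ, hbu₂, -, hlamL₂⟩ := JinvStep_lower hch hx hU hregJ
    have hfx := filter_oddCap (Pc x) hPx t₁ ht₁ t₂ ht₂ d' hd'P h12 hhex hd'hex hd1 hd2
    have hℓ₁ : ℓ₁ = d' := by
      have h1 := hfx.2.2.1
      rw [← hLeq, hfiltI] at h1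
      exact Finset.singleton_injective h1
    have hℓ₂ : ℓ₂ = d' := by
      have h1 := hfx.2.2.2
      rw [← hLeq, hfiltJ] at h1
      exact Finset.singleton_injective h1
    rw [hℓ₁] at hbu₁ hlamL₁
    rw [hℓ₂] at hbu₂ hlamL₂
    have hμ₁ := zlab_spec hch hymS hu.1 hbu₁
    have hμ₂ := zlab_spec hch hym'S hu.1 hbu₂
    have hos1 := onesided_at_lower_apex hch hx hymS hU hIi hd'L hlamL₁ hμ₁.2.symm
    have hos2 := onesided_at_lower_apex hch hx hym'S hU hJi hd'L hlamL₂ hμ₂.2.symm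
    have hos : (-ξ ∈ Pc (nb x d') ∧ -η ∈ Pc (nb x d') ∧ -ζ ∈ Pc (nb x d')) ∨
        (-ξ ∉ Pc (nb x d') ∧ -η ∉ Pc (nb x d') ∧ -ζ ∉ Pc (nb x d')) := by
      rcases hos1 with ⟨a1, a2⟩ | ⟨a1, a2⟩ <;> rcases hos2 with ⟨b1, b2⟩ | ⟨b1, b2⟩
      · exact Or.inl ⟨a1, a2, b2⟩
      · exact (b1 a1).elim
      · exact (a1 b1).elim
      · exact Or.inr ⟨a1, a2, b2⟩
    obtain ⟨hframeU, hcapeq, hparU⟩ := isFrame_capWith_even (Pc (nb x d')) hPd ξ hξ.1 η hη.1 ζ hζ.1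
      (by rw [sqNormInt_sub_comm]; exact Dηξ) (by rw [sqNormInt_sub_comm]; exact Dζξ) Dηζ hos
    have hV : VinvStep Pc nb ⟨x, t₁, t₂, U⟩ =
        ⟨nb x d', ξ - η, ξ - ζ, capWith (Pc (nb x d')) (ξ - η) (ξ - ζ) ξ⟩ := by
      simp only [VinvStep, hapexL, if_pos hlp]
      try rfl
    rw [hV]
    refine ⟨hd'L, hu.1, hu.2, hξ.1, hξ.2, hframeU, ?_, Or.inl ⟨hlp, ?_, ?_, ?_, hLeq⟩⟩
    · show frameParity (ξ - η) (ξ - ζ) (capWith (Pc (nb x d')) (ξ - η) (ξ - ζ) ξ) =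
        lowerParity t₁ t₂ (lowerCap (Pc x) t₁ t₂ U)
      rw [hlp]; exact hparU
    · show capWith (Pc (nb x d')) (ξ - η) (ξ - ζ) ξ = {ξ, ξ - (ξ - η), ξ - (ξ - ζ)}
      rw [hcapeq, sub_sub_cancel, sub_sub_cancel]
    · show nb (nb x d') (ξ - (ξ - η)) = nb x (-t₁)
      rw [sub_sub_cancel]; exact hη.2
    · show nb (nb x d') (ξ - (ξ - ζ)) = nb x (-t₂)
      rw [sub_sub_cancel]; exact hζ.2
  · /- letter below `−1`: `L = {d', d' − t₁, d' − t₂}`; the upper sites of `d` are `x, Ix, Jx` -/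
    have hdx := dist_evenCap (Pc x) hPx t₁ ht₁ t₂ ht₂ d' hd'P h12 hhex hd'hex hd1 hd2
    have hbI : B (nb x d') (nb x t₁) :=
      (bond_nb_iff hch hx hd'P ht₁).2 (by rw [sqNormInt_sub_comm]; exact hdx.2.1)
    have hbJ : B (nb x d') (nb x t₂) :=
      (bond_nb_iff hch hx hd'P ht₂).2 (by rw [sqNormInt_sub_comm]; exact hdx.1)
    have hη := zlab_spec hch hu.1 hyS hbI
    have hζ := zlab_spec hch hu.1 hy'S hbJ
    set η := zlab Pc nb (nb x d') (nb x t₁) with hη_def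
    set ζ := zlab Pc nb (nb x d') (nb x t₂) with hζ_def
    have Dηξ : sqNormInt (η - ξ) = 18 := by
      rw [hη_def, hξ_def, transfer_nb_centre hch hx hu.1 hu.2 ht₁ hbI]
      exact chart_sqNormInt_eq hch hx ht₁
    have Dζξ : sqNormInt (ζ - ξ) = 18 := by
      rw [hζ_def, hξ_def, transfer_nb_centre hch hx hu.1 hu.2 ht₂ hbJ]
      exact chart_sqNormInt_eq hch hx ht₂
    have Dηζ : sqNormInt (η - ζ) = 18 := by
      rw [hη_def, hζ_def, transfer_nb_nb hch hx hu.1 hu.2 ht₁ ht₂ hbI hbJ]; exact h12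
    have hregI : Pc (nb x t₁) = fcc3Int ∨ Pc x = hcpInt ∨
        (-zlab Pc nb (nb x t₁) x ∈ Pc (nb x t₁) ∧ -zlab Pc nb (nb x t₁) (nb x t₂) ∈ Pc (nb x t₁)) := by
      refine Or.inr (Or.inr ⟨hI.2.1 (mem_hexLabels_iff.2 (Or.inl rfl)), ?_⟩)
      have h6 := hI.2.1 (mem_hexLabels_iff.2 (Or.inr (Or.inr (Or.inr (Or.inr (Or.inr rfl))))))
      have e : (Istep Pc nb ⟨x, t₁, t₂, U⟩).t₁ - (Istep Pc nb ⟨x, t₁, t₂, U⟩).t₂ =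
          -zlab Pc nb (nb x t₁) (nb x t₂) := by
        show -zlab Pc nb (nb x t₁) x - (zlab Pc nb (nb x t₁) (nb x t₂) - zlab Pc nb (nb x t₁) x) = _
        abel
      rwa [e] at h6
    have hregJ : Pc (nb x t₂) = fcc3Int ∨ Pc x = hcpInt ∨
        (-zlab Pc nb (nb x t₂) x ∈ Pc (nb x t₂) ∧ -zlab Pc nb (nb x t₂) (nb x t₁) ∈ Pc (nb x t₂)) := by
      refine Or.inr (Or.inr ⟨hJ.2.1 (mem_hexLabels_iff.2 (Or.inr (Or.inl rfl))), ?_⟩)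
      have h3 := hJ.2.1 (mem_hexLabels_iff.2 (Or.inr (Or.inr (Or.inl rfl))))
      have e : (Jstep Pc nb ⟨x, t₁, t₂, U⟩).t₂ - (Jstep Pc nb ⟨x, t₁, t₂, U⟩).t₁ =
          -zlab Pc nb (nb x t₂) (nb x t₁) := by
        show -zlab Pc nb (nb x t₂) x - (zlab Pc nb (nb x t₂) (nb x t₁) - zlab Pc nb (nb x t₂) x) = _
        abel
      rwa [e] at h3
    obtain ⟨ℓ₁, -, -, hfiltI, hbu₁, -, hlamL₁⟩ := Istep_lower hch hx hU hregI
    obtain ⟨ℓ₂, -, -, hfiltJ, hbu₂, -, hlamL₂⟩ := Jstep_lower hch hx hU hregJ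
    have hfx := filter_evenCap (Pc x) hPx t₁ ht₁ t₂ ht₂ d' hd'P h12 hhex hd'hex hd1 hd2
    have hℓ₁ : ℓ₁ = d' := by
      have h1 := hfx.1
      rw [← hLeq, hfiltI] at h1
      exact Finset.singleton_injective h1
    have hℓ₂ : ℓ₂ = d' := by
      have h1 := hfx.2.1
      rw [← hLeq, hfiltJ] at h1
      exact Finset.singleton_injective h1
    rw [hℓ₁] at hbu₁ hlamL₁
    rw [hℓ₂] at hbu₂ hlamL₂
    have hμ₁ := zlab_spec hch hyS hu.1 hbu₁
    have hμ₂ := zlab_spec hch hy'S hu.1 hbu₂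
    have hos1 := onesided_at_lower_apex hch hx hyS hU hI hd'L hlamL₁ hμ₁.2.symm
    have hos2 := onesided_at_lower_apex hch hx hy'S hU hJ hd'L hlamL₂ hμ₂.2.symm
    have hos : (-ξ ∈ Pc (nb x d') ∧ -η ∈ Pc (nb x d') ∧ -ζ ∈ Pc (nb x d')) ∨
        (-ξ ∉ Pc (nb x d') ∧ -η ∉ Pc (nb x d') ∧ -ζ ∉ Pc (nb x d')) := by
      rcases hos1 with ⟨a1, a2⟩ | ⟨a1, a2⟩ <;> rcases hos2 with ⟨b1, b2⟩ | ⟨b1, b2⟩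
      · exact Or.inl ⟨a1, a2, b2⟩
      · exact (b1 a1).elim
      · exact (a1 b1).elim
      · exact Or.inr ⟨a1, a2, b2⟩
    obtain ⟨hframeU, hcapeq, hparU⟩ := isFrame_capWith_odd (Pc (nb x d')) hPd ξ hξ.1 η hη.1 ζ hζ.1
      (by rw [sqNormInt_sub_comm]; exact Dηξ) (by rw [sqNormInt_sub_comm]; exact Dζξ) Dηζ hos
    have hne : ¬ lowerParity t₁ t₂ (lowerCap (Pc x) t₁ t₂ U) = 1 := by rw [hlp]; norm_num
    have hV : VinvStep Pc nb ⟨x, t₁, t₂, U⟩ =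
        ⟨nb x d', η - ξ, ζ - ξ, capWith (Pc (nb x d')) (η - ξ) (ζ - ξ) ξ⟩ := by
      simp only [VinvStep, hapexL, if_neg hne]
      try rfl
    rw [hV]
    refine ⟨hd'L, hu.1, hu.2, hξ.1, hξ.2, hframeU, ?_, Or.inr ⟨hlp, ?_, ?_, ?_, hLeq⟩⟩
    · show frameParity (η - ξ) (ζ - ξ) (capWith (Pc (nb x d')) (η - ξ) (ζ - ξ) ξ) =
        lowerParity t₁ t₂ (lowerCap (Pc x) t₁ t₂ U)
      rw [hlp]; exact hparU
    · show capWith (Pc (nb x d')) (η - ξ) (ζ - ξ) ξ = {ξ, ξ + (η - ξ), ξ + (ζ - ξ)}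
      rw [hcapeq, show ξ + (η - ξ) = η by abel, show ξ + (ζ - ξ) = ζ by abel]
    · show nb (nb x d') (ξ + (η - ξ)) = nb x t₁
      rw [show ξ + (η - ξ) = η by abel]; exact hη.2
    · show nb (nb x d') (ξ + (ζ - ξ)) = nb x t₂
      rw [show ξ + (ζ - ξ) = ζ by abel]; exact hζ.2

omit hch in
/-! ## Registered anchor (closed form) -/

omit hch in
/-- **Closed form of `polar_at_lower_apex`** (the registered anchor of this file): the section data
`S, B, Pc, nb` and the standing hypothesis written out (two hypotheses regrouped). [folklore] -/
theorem polar_at_lower_apex_graded :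
    ∀ {S : ℕ → Set (EuclideanSpace ℝ (Fin 3))} {B : EuclideanSpace ℝ (Fin 3) → EuclideanSpace ℝ
    (Fin 3) → Prop} {Pc : EuclideanSpace ℝ (Fin 3) → Finset (Fin 3 → ℤ)} {nb : EuclideanSpace ℝ
    (Fin 3) → (Fin 3 → ℤ) → EuclideanSpace ℝ (Fin 3)}, ((∀ n : ℕ, ∀ z ∈ S n, (Pc z =
    Summit.AtomisticToContinuum.Crystallization.Theorems.PalmUnimodularRigidityShellsToBarlowChart.fcc3Int
    ∨ Pc z = Literature.Geometry.DiscreteGeometry.hcpInt) ∧ Set.BijOn (nb z) (↑(Pc z) : Set (Fin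
    3 → ℤ)) {y | B z y} ∧ ∀ t ∈ Pc z, ∀ t' ∈ Pc z, (B (nb z t) (nb z t') ↔
    Literature.Geometry.DiscreteGeometry.sqNormInt (t - t') = 18)) ∧ (∀ n : ℕ, ∀ z ∈ S (n + 1),
    ∀ y, B z y → y ∈ S n) ∧ (∀ n m : ℕ, ∀ x ∈ S n, ∀ y ∈ S m, B x y → ∀ (z z' : EuclideanSpace ℝ
    (Fin 3)) (t t' u u' : Fin 3 → ℤ), (t = 0 ∧ z = x ∨ t ∈ Pc x ∧ z = nb x t) → (t' = 0 ∧ z' = x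
    ∨ t' ∈ Pc x ∧ z' = nb x t') → (u = 0 ∧ z = y ∨ u ∈ Pc y ∧ z = nb y u) → (u' = 0 ∧ z' = y ∨
    u' ∈ Pc y ∧ z' = nb y u') → Literature.Geometry.DiscreteGeometry.sqNormInt (u - u') =
    Literature.Geometry.DiscreteGeometry.sqNormInt (t - t')) ∧ (∀ x y, B x y → B y x)) → ∀ {n :
    ℕ} {x : (EuclideanSpace ℝ (Fin 3))} {t₁ t₂ : Fin 3 → ℤ} {U : Finset (Fin 3 → ℤ)} {c : Fin 3
    → ℤ},
    Summit.AtomisticToContinuum.Crystallization.Theorems.PalmUnimodularRigidityShellsToBarlowChart.IsFrame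
    (Pc x) t₁ t₂ U → x ∈ S (n + 2) → c ∈
    Summit.AtomisticToContinuum.Crystallization.Theorems.PalmUnimodularRigidityShellsToBarlowChart.lowerCap
    (Pc x) t₁ t₂ U → Pc (nb x c) = Literature.Geometry.DiscreteGeometry.hcpInt →
    -Summit.AtomisticToContinuum.Crystallization.Theorems.PalmUnimodularRigidityShellsToBarlowChart.zlab
    Pc nb (nb x c) x ∉ Pc (nb x c) := by
  intro S B Pc nb hch n x t₁ t₂ U c hU hx hcL hhcp
  exact polar_at_lower_apex hch hx hU hcL hhcp

end Summit.AtomisticToContinuum.Crystallization.Theorems.SquareWellLayerCakeGapTwelveToBarlow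

end
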